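import Summits.RiemannHypothesis.RiemannHypothesis.Theses.WeilComb
import Summits.RiemannHypothesis.RiemannHypothesis.Theorems.WeilCombCombShapePositivityWindowCoreConeK11
import Literature.NumberTheory.LFunctions.WeilExplicit
import Literature.NumberTheory.LFunctions.WeilMellinBounds
import Literature.NumberTheory.LFunctions.WeilArchimedeanMoments
import Literature.NumberTheory.LFunctions.ChebyshevPsiExplicitPartialRH
import Literature.NumberTheory.LFunctions.PsiTailIntegralExplicit
import Literature.NumberTheory.LFunctions.ZetaZeroTailSums
import Literature.NumberTheory.LFunctions.RiemannHypothesisUpTo2516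
import Literature.NumberTheory.LFunctions.RosserSchoenfeldMertensFirstConstant
import Literature.NumberTheory.LFunctions.MertensFirstChainSound
import Literature.NumberTheory.LFunctions.MertensFirstChainRun2
import Mathlib.NumberTheory.Harmonic.Bounds
import Mathlib.Analysis.InnerProductSpace.Basic

/-!
# STUB-PLAN `stub_windowCore` — typed helper statements (stub-critic merge of ideators k1/k2/k3)

Elaboration-only companion of `STUB-PLAN-stub_windowCore.md` (crux stmt-RiemannHypothesis-11229,
`WeilComb.CombShapePositivity`, line `Sketch`, skeleton v7 sha 86d35e56). Every `sorry` is a helper lemma of the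
plan; the two GLUE theorems (`stub_windowCore_of_topCells_split`, `windowCore_of_mid_top`) are kernel-checked.
Registered stubs must be re-stated fully inlined (pattern: `perp_coercivity_topCells_inline`).
-/

noncomputable section

set_option linter.dupNamespace false

open scoped BigOperators ComplexConjugate InnerProductSpace Chebyshev
open Complex MeasureTheory

namespace Summit.RiemannHypothesis.RiemannHypothesis.Cruxes.CombShapePositivity.StubPlanWindowCore

open Literature.NumberTheory.LFunctions
open Literature.Analysis.SpecialFunctions (reDigammaQuarter)

/-! ## 0. Objects (local abbreviations; registered stubs inline them) -/

/-- the fixed bump `φ₀` -/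
def phi0 : ℝ → ℂ := fun u : ℝ => ((expNegInvGlue (1 - u ^ 2) : ℝ) : ℂ)
/-- `φ_ε(t) = ε⁻¹ φ₀(t/ε)` -/
def phiE (ε : ℝ) : ℝ → ℂ := fun t : ℝ => (ε : ℂ)⁻¹ * ((expNegInvGlue (1 - (t / ε) ^ 2) : ℝ) : ℂ)
/-- `ψ_ε = φ_ε ⋆ φ̃_ε` -/
def psiE (ε : ℝ) : ℝ → ℂ := weilConv (phiE ε) (weilReflect (phiE ε))
/-- the comb `g_a = Σ_{m ≤ M} a_m φ_ε(· − log m)` (verbatim shape of the crux) -/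
def comb (ε : ℝ) (M : ℕ) (a : ℕ → ℂ) : ℝ → ℂ := fun x : ℝ => ∑ m ∈ Finset.Icc 1 M,
  a m * ((ε : ℂ)⁻¹ * ((expNegInvGlue (1 - ((x - Real.log (m : ℝ)) / ε) ^ 2) : ℝ) : ℂ))
/-- the Perron ray `u_m = m^{-1/2}` -/
def perron : ℕ → ℂ := fun k : ℕ => ((Real.sqrt (k : ℝ) : ℝ) : ℂ)⁻¹
/-- `I₀ = ∫ φ₀`, `N₀ = ‖φ₀‖₂²` (`U = ε⁻¹ N₀`) -/
def I0 : ℝ := ∫ u : ℝ, expNegInvGlue (1 - u ^ 2)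
def N0 : ℝ := weilNorm2Sq phi0
/-- Dirichlet energy `D(a) = Σ_m Σ_{n ≤ M/m} Λ(n) ‖a(nm) − n^{-1/2} a(m)‖²` -/
def dirichletD (M : ℕ) (a : ℕ → ℂ) : ℝ :=
  ∑ m ∈ Finset.Icc 1 M, ∑ n ∈ Finset.Icc 1 (M / m),
    (ArithmeticFunction.vonMangoldt n : ℝ) * ‖a (n * m) - ((Real.sqrt n : ℂ))⁻¹ * a m‖ ^ 2
/-- mass `L(a) = Σ ‖a_m‖²` -/
def massL (M : ℕ) (a : ℕ → ℂ) : ℝ := ∑ m ∈ Finset.Icc 1 M, ‖a m‖ ^ 2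
/-- Helson form `H(a) = 2 Re Σ_m Σ_{n ≤ M/m} Λ(n) n^{-1/2} a(nm) conj a(m)` -/
def helsonH (M : ℕ) (a : ℕ → ℂ) : ℝ :=
  2 * (∑ m ∈ Finset.Icc 1 M, ∑ n ∈ Finset.Icc 1 (M / m),
    ((ArithmeticFunction.vonMangoldt n : ℝ) : ℂ) / (Real.sqrt n : ℂ) * a (n * m) * conj (a m)).re
/-- `ψ₁(y) = Σ_{n ≤ y} Λ(n)/n` and the Mertens remainder `E₁(y) = ψ₁(y) − log y + γ` -/
def psiOne (y : ℝ) : ℝ := ∑ n ∈ Finset.Icc 1 ⌊y⌋₊, (ArithmeticFunction.vonMangoldt n : ℝ) / n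
def E1 (y : ℝ) : ℝ := psiOne y - Real.log y + Real.eulerMascheroniConstant
/-- Bombieri's off-diagonal kernel `g(t) = e^{t/2}/(2 sinh t)` -/
def gker (t : ℝ) : ℝ := Real.exp (t / 2) / (2 * Real.sinh t)

/-- The registered stub's inequality (verbatim body of `stub_windowCore`, incl. the digamma factor). -/
def CoreIneq (ε : ℝ) (M : ℕ) (a : ℕ → ℂ) : Prop :=
    ε⁻¹ * weilNorm2Sq (fun u : ℝ => ((expNegInvGlue (1 - u ^ 2) : ℝ) : ℂ)) *
        (2 * (∑ m ∈ Finset.Icc 1 M, ∑ n ∈ Finset.Icc 1 (M / m),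
            ((ArithmeticFunction.vonMangoldt n : ℝ) : ℂ) / (Real.sqrt n : ℂ) * a (n * m) *
              conj (a m)).re
          + Real.log Real.pi * ∑ m ∈ Finset.Icc 1 M, ‖a m‖ ^ 2) ≤
      2 * (weilMellin (fun t : ℝ => (ε : ℂ)⁻¹ * ((expNegInvGlue (1 - (t / ε) ^ 2) : ℝ) : ℂ)) 0 *
            conj (weilMellin (fun t : ℝ => (ε : ℂ)⁻¹ * ((expNegInvGlue (1 - (t / ε) ^ 2) : ℝ) : ℂ)) 1) *
          ((∑ m ∈ Finset.Icc 1 M, a m * ((Real.sqrt (m : ℝ) : ℝ) : ℂ)⁻¹) *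
            conj (∑ m ∈ Finset.Icc 1 M, a m * ((Real.sqrt (m : ℝ) : ℝ) : ℂ)))).re
      + 1 / (2 * Real.pi) * ∫ t : ℝ,
          ‖weilMellin (fun t : ℝ => (ε : ℂ)⁻¹ * ((expNegInvGlue (1 - (t / ε) ^ 2) : ℝ) : ℂ))
              (1 / 2 + t * I)‖ ^ 2 *
            ‖∑ m ∈ Finset.Icc 1 M, a m * cexp (t * I * (Real.log (m : ℝ) : ℂ))‖ ^ 2 *
            (Complex.digamma (1 / 4 + t / 2 * I)).re

/-- Theorem B on the TOP CELLS `2ε(M+1) ≤ 1 < 2ε(M+2)` over real vectors, levels `M₀ ≤ M`. -/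
def TopCellsFrom (M₀ : ℕ) : Prop :=
  ∀ ε : ℝ, 0 < ε → ∀ (M : ℕ) (b : ℕ → ℝ), M₀ ≤ M → 2 * ε * ((M : ℝ) + 1) ≤ 1 →
    1 < 2 * ε * ((M : ℝ) + 2) →
    0 ≤ (weilQuadratic (fun x : ℝ => ∑ m ∈ Finset.Icc 1 M,
      ((b m : ℝ) : ℂ) * ((ε : ℂ)⁻¹ * ((expNegInvGlue (1 - ((x - Real.log (m : ℝ)) / ε) ^ 2) : ℝ) : ℂ)))).re

/-- Theorem B on the top cells of levels `2 ≤ M < M₀` (the CERTIFIED-CELLS complement; computational). -/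
def TopCellsBelow (M₀ : ℕ) : Prop :=
  ∀ ε : ℝ, 0 < ε → ∀ (M : ℕ) (b : ℕ → ℝ), 2 ≤ M → M < M₀ → 2 * ε * ((M : ℝ) + 1) ≤ 1 →
    1 < 2 * ε * ((M : ℝ) + 2) →
    0 ≤ (weilQuadratic (fun x : ℝ => ∑ m ∈ Finset.Icc 1 M,
      ((b m : ℝ) : ℂ) * ((ε : ℂ)⁻¹ * ((expNegInvGlue (1 - ((x - Real.log (m : ℝ)) / ε) ^ 2) : ℝ) : ℂ)))).re

/-- **GLUE 1 (kernel-checked): the stub from the two halves of the top cells**, through the landed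
`stub_windowCore_iff_topCells_real` (…WindowCoreConeK11). The band edge `1/40` is immaterial. -/
theorem stub_windowCore_of_topCells_split (M₀ : ℕ) (hlo : TopCellsBelow M₀) (hhi : TopCellsFrom M₀) :
    ∀ ε : ℝ, 0 < ε → ∀ (M : ℕ) (a : ℕ → ℂ), 1 ≤ M → 1 / 40 < ε * M →
      2 * ε * ((M : ℝ) + 1) ≤ 1 → CoreIneq ε M a := by
  have h := (Summit.RiemannHypothesis.RiemannHypothesis.Theorems.WeilCombBohrFejer.stub_windowCore_iff_topCells_real).2
    (fun ε hε M b hM hw htop => by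
      rcases Nat.lt_or_ge M M₀ with hlt | hge
      · exact hlo ε hε M b hM hlt hw htop
      · exact hhi ε hε M b hge hw htop)
  intro ε hε M a hM hlam hw
  exact h ε hε M a hM hlam hw

/-! ## Phase A — the Mertens input (in-tree, hypothesis-free) and the sharp Helson potential -/

/-- **A1 (MertensIdentity)**: Abel summation + `integral_Ioi_psi_sub_self_div_sq` (`= −1 − γ`). [S] -/
theorem mertensIdentity : ∀ x : ℝ, 1 < x →
    psiOne x = Real.log x - Real.eulerMascheroniConstant + (ψ x - x) / x
      - ∫ t in Set.Ioi x, (ψ t - t) / t ^ 2 := by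
  sorry

/-- **A2 (MertensConst, k3-L1)**: `|E₁(x)| ≤ 1/50` for `x ≥ 442439`, from `PsiFromZeros2516.abs_psi_sub_self_le`,
`PsiTailIntegral.abs_integral_Ioi_psi_sub_self_div_sq_le`, `PsiTailIntegral.rsK_le_of_inStripUpTo riemannHypothesisInStripUpTo_2516`,
`ZetaZeroTails.tailInvNormProd_le`, `ZetaZeroTails.Gtail_le`, `sumInvNormSq 2516 ≤ sumInvNorm 2516 / 14 ≤ 5.681/14`
(`SchoenfeldBound.sumInvNorm_heightT0_le` + first zero height `> 14`). Sum: `0.00862 + 6.13/√x + 1.9/x + 1.06e-3 ≤ 0.0189`. [S–M] -/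
theorem mertens_E1_abs_le : ∀ x : ℝ, 442439 ≤ x → |E1 x| ≤ 1 / 50 := by
  sorry

/-- the four in-tree inputs of A2, instantiated (names/types as used) -/
example {x : ℝ} (hx : 9 ≤ x) : |ψ x - x| ≤ 0.00862 * x + 5.72 * Real.sqrt x + 1.838 :=
  PsiFromZeros2516.abs_psi_sub_self_le hx
example {x : ℝ} (hx : 1 ≤ x) :
    PsiTailIntegral.rsK x ≤ x ^ (-(1 / 2 : ℝ)) * SchoenfeldBound.sumInvNormSq 2516
      + PsiTailIntegral.tailInvNormProd 2516 :=
  PsiTailIntegral.rsK_le_of_inStripUpTo riemannHypothesisInStripUpTo_2516 hx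
example : PsiTailIntegral.tailInvNormProd 2516 ≤ 2 * SchoenfeldBound.Gtail 2516 :=
  ZetaZeroTails.tailInvNormProd_le le_rfl
example {x : ℝ} (hx : 1 < x) :
    |∫ t in Set.Ioi x, (ψ t - t) / t ^ 2| ≤
      PsiTailIntegral.rsK x + Real.log (2 * Real.pi) / x + 1 / (2 * x * (x ^ 2 - 1)) :=
  PsiTailIntegral.abs_integral_Ioi_psi_sub_self_div_sq_le hx

/-- **A3 (mid range, k1-L3)**: the kernel-certified Rosser–Schoenfeld (3.22) chain (`MertensFirstChain.eq_3_22_of_inv`,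
`initM_inv`, `runDM_sound`, `MertensFirstChainRun.run1/run2`, `rosserSchoenfeldE_ge_of_inv`) plus prime powers
`Σ_{p^k ≤ x, k ≥ 2} log p/p^k ≤ Σ_p log p/(p(p−1)) = −γ − E`: `ψ₁(x) < log x − γ + 1/(2 log x)` on `[319, 442439]`. [S–M] -/
theorem psiOne_lt_midrange : ∀ x : ℝ, 319 ≤ x → x ≤ 442439 →
    psiOne x < Real.log x - Real.eulerMascheroniConstant + 1 / (2 * Real.log x) := by
  sorry

/-- **A4 (small range table)**: for `1 ≤ y < 319`, `E₁(y) ≤ 87/1000 + w(y)` with the explicit step function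
`w = (E₁ − 0.087)⁺·1_{y<20}` (support `[1,1.64)∪[2,2.31)∪[3,3.33)∪[5,5.46)∪[7,7.21)∪[11,11.06)∪[13,13.47)∪[19,19.4)`, `w ≤ 49/100`);
finite prime tables + `Real.log` decimal kit. Stated with `w` abstract so the prover can choose the rational steps. [M] -/
def SmallRangeTable (w : ℝ → ℝ) : Prop :=
  (∀ y, 0 ≤ w y) ∧ (∀ y, w y ≤ 49 / 100) ∧ (∀ y, 20 ≤ y → w y = 0) ∧
    ∀ y : ℝ, 1 ≤ y → y < 319 → E1 y ≤ 87 / 1000 + w y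

/-- **A5 (HelsonPotentialSharp, k3-L2)** = A2 + A3 + A4 pointwise: `log m + ψ₁(M/m) ≤ log M − γ + 0.087 + w(M/m)`. [S given A2–A4] -/
theorem helsonPotential_sharp {w : ℝ → ℝ} (hw : SmallRangeTable w)
    (hmid : ∀ x : ℝ, 319 ≤ x → x ≤ 442439 → psiOne x < Real.log x - Real.eulerMascheroniConstant + 1 / (2 * Real.log x))
    (htail : ∀ x : ℝ, 442439 ≤ x → |E1 x| ≤ 1 / 50) :
    ∀ M : ℕ, 1 ≤ M → ∀ m ∈ Finset.Icc 1 M,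
      Real.log m + psiOne ((M : ℝ) / m) ≤
        Real.log M - Real.eulerMascheroniConstant + 87 / 1000 + w ((M : ℝ) / m) := by
  sorry

/-- by-product (M-uniform, replaces `helsonPotential_le_three_twentieths`' `+3/20` by `0`): `ψ₁(y) ≤ log y` for all `y ≥ 1`,
i.e. `E₁ ≤ γ` (equality only at `y = 1`). [S given A2–A4] -/
theorem psiOne_le_log : ∀ y : ℝ, 1 ≤ y → psiOne y ≤ Real.log y := by
  sorry

/-- **A6 (TopLayerTrace, k3-L3)**: the top-layer excess is paid by Dirichlet energy plus `O(L/log M)`: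
divisor-averaged AM–GM `‖a_m‖² ≤ (1+η)Σ_{n∣m}(Λ(n)/(n log m))‖a_{m/n}‖² + ((1+1/η)/log m)Σ_{n∣m}Λ(n)‖a_m − n^{-1/2}a_{m/n}‖²`
on the layer `m > M/20`, and the window constant `sup_y Σ_{n≤y}(Λ(n)/n) w(y/n) ≤ 7/20` (finite check; truth 0.209).
Constants: `c₁ = (1+1/η)·(49/100)·log M/log(M/20)`, `c₂ = (1+η)·(7/20)·log M/log(M/20)`; `η = 1/2`. [M] -/
theorem topLayerTrace {w : ℝ → ℝ} (hw : SmallRangeTable w) :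
    ∀ M : ℕ, 400 ≤ M → ∀ a : ℕ → ℂ,
      ∑ m ∈ Finset.Icc 1 M, w ((M : ℝ) / m) * ‖a m‖ ^ 2 ≤
        (3 / 2) / Real.log ((M : ℝ) / 20) * dirichletD M a + (11 / 20) / Real.log ((M : ℝ) / 20) * massL M a := by
  sorry

/-- **A7 (HelsonSharp, large M)** = identity `H = V − D` (`WeilCombSubcritical.stub_identity`) + A5 + A6:
`H(a) ≤ (log M − 49/100 + (11/20)/log(M/20))·L − (1 − (3/2)/log(M/20))·D`. [S given A5, A6] -/
theorem helsonSharp_large : ∀ M : ℕ, 400 ≤ M → ∀ a : ℕ → ℂ,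
    helsonH M a ≤ (Real.log M - 49 / 100 + (11 / 20) / Real.log ((M : ℝ) / 20)) * massL M a
      - (1 - (3 / 2) / Real.log ((M : ℝ) / 20)) * dirichletD M a := by
  sorry

/-- **A8 (HelsonSmallCertified, k3-L4)**: `2 ≤ M < 400`: `H(a) ≤ (log M − c)·L` by ≈ 60 kernel-checked
Collatz–Wielandt certificates at `1.1`-adic checkpoints (monotonicity of `λ_max` of the nonnegative Helson matrix in `M`). [M, kernel compute] -/
def HelsonSmallCertified (M₀ : ℕ) (c : ℝ) : Prop := ∀ M : ℕ, 2 ≤ M → M < M₀ → ∀ a : ℕ → ℂ,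
  helsonH M a ≤ (Real.log M - c) * massL M a

/-- **GLUE 2 (kernel-checked, k3)**: if the lead re-cuts the band at `λ₁` — `Mid` (bookkeeping, provable now) + `Top` (residual). -/
theorem windowCore_of_mid_top (lam1 : ℝ)
    (hmid : ∀ ε : ℝ, 0 < ε → ∀ (M : ℕ) (a : ℕ → ℂ), 1 ≤ M → 1 / 40 < ε * M → ε * M ≤ lam1 →
      CoreIneq ε M a)
    (htop : ∀ ε : ℝ, 0 < ε → ∀ (M : ℕ) (a : ℕ → ℂ), 1 ≤ M → lam1 < ε * M →
      2 * ε * ((M : ℝ) + 1) ≤ 1 → CoreIneq ε M a) :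
    ∀ ε : ℝ, 0 < ε → ∀ (M : ℕ) (a : ℕ → ℂ), 1 ≤ M → 1 / 40 < ε * M →
      2 * ε * ((M : ℝ) + 1) ≤ 1 → CoreIneq ε M a := by
  intro ε hε M a hM hlo hw
  by_cases h : ε * M ≤ lam1
  · exact hmid ε hε M a hM hlo h
  · exact htop ε hε M a hM (lt_of_not_ge h) hw

/-! ## Phase B — the top cells: Perron(-Ritz) pivot Schur complement -/

/-- **B0 (certified bump constants, prerequisite of B3/B4)**: two-sided `R = I₀²/N₀` to `±0.002` and the archimedean
diagonal constant `c_d = log 4π + γ + J`, `J = ∫₀² (ψ₀(τ)/ψ₀(0) − 1) dτ/τ`, to `±0.002` (Bombieri x-space form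
`weilArchTermBombieri_eq_weilArchTerm_holds`; `∫_{2ε}^∞ dt/sinh t = log coth ε`). Rationals below are TARGET enclosures
(truth `R = 1.4812`, `J = −1.1528`, `c_d = 1.9554`); the prover fixes them from the certificate. [M–L, certified numerics] -/
theorem bump_ratio_enclosure : (14795 / 10000 : ℝ) * N0 ≤ I0 ^ 2 ∧ I0 ^ 2 ≤ (14830 / 10000 : ℝ) * N0 := by
  sorry

theorem archDiag_sharp : ∀ ε : ℝ, 0 < ε → ε ≤ 1 / 4 →
    ε⁻¹ * N0 * (Real.log (1 / ε) - 19575 / 10000) - 2 * I0 ^ 2 ≤ (weilArchTerm (psiE ε)).re ∧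
    (weilArchTerm (psiE ε)).re ≤ ε⁻¹ * N0 * (Real.log (1 / ε) - 19535 / 10000) + 2 * I0 ^ 2 := by
  sorry

/-- **B1 (window-uniform arch entry bounds, k2-HL2)**: for `x > 2ε`,
`−I₀²(g(x) + (C−1)(2ε/x)²/(2x) + ε) ≤ Re W_∞(τ_x ψ_ε) ≤ −I₀² g(x)` (Jensen up; kernel averaging down), `C = C_T ≈ 1.1`,
any certified `C ≤ 2`. Sharpens the landed `weilArchTerm_translate_psi_offdiag_bounds` (`g(x ∓ 2ε)`), which degenerates on top cells. [M] -/
theorem arch_entry_bounds_window (C : ℝ)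
    (hC : ∫ v : ℝ, (weilConv phi0 (weilReflect phi0) v).re / (1 - (v / 2) ^ 2) ≤ C * I0 ^ 2) :
    ∀ ε : ℝ, 0 < ε → ∀ x : ℝ, 2 * ε < x →
      -(I0 ^ 2 * (gker x + (C - 1) * (2 * ε / x) ^ 2 / (2 * x) + ε)) ≤
          (weilArchTerm (weilTranslate (psiE ε) x)).re ∧
        (weilArchTerm (weilTranslate (psiE ε) x)).re ≤ -(I0 ^ 2 * gker x) := by
  sorry

/-- **B2a (Perron rows in closed form, k2-HL3a/b = the harmonic identity inside `stub_offdiagSchur` p109602)**. [S] -/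
theorem gker_log_ratio (m m' : ℕ) (hm' : 0 < m') (hlt : m' < m) :
    gker (Real.log m - Real.log m') * (Real.sqrt (m' : ℝ))⁻¹ =
      (m : ℝ) * Real.sqrt (m : ℝ) / ((m : ℝ) ^ 2 - (m' : ℝ) ^ 2) := by
  sorry

theorem perron_arch_rowSum (M m : ℕ) (hm : 1 ≤ m) (hmM : m ≤ M) :
    ∑ m' ∈ Finset.Ico 1 m, (m : ℝ) * Real.sqrt (m : ℝ) / ((m : ℝ) ^ 2 - (m' : ℝ) ^ 2) +
      ∑ m' ∈ Finset.Ioc m M, (m' : ℝ) * Real.sqrt (m : ℝ) / ((m' : ℝ) ^ 2 - (m : ℝ) ^ 2) =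
      Real.sqrt (m : ℝ) / 2 * ((harmonic (M - m) : ℝ) + (harmonic (M + m) : ℝ) - 3 / (2 * (m : ℝ))) := by
  sorry

/-- **B2b (screening profile, k2-HL3c)**: `0 ≤ s_M(m) := 2H_M − H_{M−m} − H_{M+m} + 3/(2m)` and
`2H_M − H_{M−m} − H_{M+m} ≤ −log(1 − (m/M)²) + 1/(M−m)` — the pole row `+RεH_M√m` and the archimedean Perron row cancel to
the boundary layer `(Rε/2)√m s_M(m)`. [S] -/
theorem screening_profile_bounds (M m : ℕ) (hm : 1 ≤ m) (hmM : m < M) :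
    0 ≤ 2 * (harmonic M : ℝ) - (harmonic (M - m) : ℝ) - (harmonic (M + m) : ℝ) + 3 / (2 * (m : ℝ)) ∧
    2 * (harmonic M : ℝ) - (harmonic (M - m) : ℝ) - (harmonic (M + m) : ℝ) ≤
      -Real.log (1 - ((m : ℝ) / M) ^ 2) + 1 / ((M : ℝ) - m) := by
  sorry

/-- **B2c (Perron is an exact eigen-row of Helson-minus-potential, k1-L4)**: the prime part of the pivot residual is
the explicit profile `u_m·(E₁(M/m) − mean)`. [S] -/
theorem helson_perron_row (M m : ℕ) (hm : m ∈ Finset.Icc 1 M) :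
    ∑ n ∈ m.divisors, (ArithmeticFunction.vonMangoldt n : ℝ) / Real.sqrt n *
        (Real.sqrt (((m / n : ℕ) : ℝ)))⁻¹ +
      ∑ n ∈ Finset.Icc 1 (M / m), (ArithmeticFunction.vonMangoldt n : ℝ) / Real.sqrt n *
        (Real.sqrt (((n * m : ℕ) : ℝ)))⁻¹ =
      (Real.sqrt (m : ℝ))⁻¹ * (Real.log m + psiOne ((M : ℝ) / m)) := by
  sorry

variable {V : Type*} [NormedAddCommGroup V] [InnerProductSpace ℂ V]

/-- **B3 (pivot Schur complement, k2-HL4; sibling of the landed `temple_inner`)**: `Re⟪Ku,u⟫ ≥ μ`, `|⟪Ku,h⟫|² ≤ c‖h‖²` and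
`Re⟪Kh,h⟫ ≥ κ‖h‖²` on `h ⊥ u`, `c ≤ μκ` ⟹ PSD. Rank-`r` Ritz version: replace `u` by an `r`-frame and `μ` by the bottom
eigenvalue of the `r×r` pivot block. [S abstract; M for the coordinate instantiation via `stub_gram`] -/
theorem schur_pivot (K : V →ₗ[ℂ] V) (hK : ∀ x y : V, ⟪K x, y⟫_ℂ = ⟪x, K y⟫_ℂ) (u : V)
    {μ κ c : ℝ} (hμ : 0 ≤ μ) (hκ : 0 ≤ κ) (hRay : μ ≤ (⟪K u, u⟫_ℂ).re)
    (hres : ∀ h : V, ⟪u, h⟫_ℂ = 0 → ‖⟪K u, h⟫_ℂ‖ ^ 2 ≤ c * ‖h‖ ^ 2)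
    (hcoer : ∀ h : V, ⟪u, h⟫_ℂ = 0 → κ * ‖h‖ ^ 2 ≤ (⟪K h, h⟫_ℂ).re)
    (hclose : c ≤ μ * κ) (a : V) :
    0 ≤ (⟪K a, a⟫_ℂ).re := by
  sorry

/-- **B4 (Perron Rayleigh quotient on top cells, k2-HL8; register as `stub_perronRayleighTop`)**: Λ-FREE by
`perron_helson_eq`/`perron_potential_eq` (`V(u) = 2Σ log k/k`), pole `2F_ε²·H_M·M` (`perron_polarSums`), diagonal B0,
off-diagonal rows B1+B2a: `Re Q(g_u) ≥ μ̂·U·H_M`, `μ̂ = 1/20` (`m_∞(1/2) = R/2 − log 2π − J = 0.0555`; 10 % proof budget). [M–L] -/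
theorem perron_rayleigh_topCells : ∀ ε : ℝ, 0 < ε → ∀ M : ℕ, 400 ≤ M →
    2 * ε * ((M : ℝ) + 1) ≤ 1 → 1 < 2 * ε * ((M : ℝ) + 2) →
    1 / 20 * (ε⁻¹ * N0) * (∑ m ∈ Finset.Icc 1 M, (1 : ℝ) / m) ≤ (weilQuadratic (comb ε M perron)).re := by
  sorry

/-- **B5 (screened cross term, k2-HL7; register as `stub_perronCrossTop`)**: for `y ⊥ u`,
`|W(g_u ⋆ g̃_y)|² ≤ c_*·U²·‖y‖²`, `c_* = 1/16` (numerics 0.044–0.049 to M = 3000; siege k8 `0.043`): pole row and arch row cancel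
(B2b), arch smoothing by B1, prime row `= −E₁(M/m)u_m` (B2c) with |E₁| from A2–A4, then Cauchy–Schwarz / explicit ℓ² sums. [M–L] -/
theorem perron_cross_topCells : ∀ ε : ℝ, 0 < ε → ∀ (M : ℕ) (y : ℕ → ℂ), 400 ≤ M →
    2 * ε * ((M : ℝ) + 1) ≤ 1 → 1 < 2 * ε * ((M : ℝ) + 2) →
    ∑ m ∈ Finset.Icc 1 M, y m * ((Real.sqrt (m : ℝ) : ℝ) : ℂ)⁻¹ = 0 →
    ‖weilFunctional (weilConv (comb ε M perron) (weilReflect (comb ε M y)))‖ ^ 2 ≤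
      1 / 16 * (ε⁻¹ * N0) ^ 2 * ∑ m ∈ Finset.Icc 1 M, ‖y m‖ ^ 2 := by
  sorry

/-- **B6 (divisor-graph gap on the Perron complement, k2-HL5; register as `stub_divisorGap`)**: `M ≥ 12`, `y ⊥ u` ⟹ `‖y‖² ≤ D(y)`
(numerics: bottom = 2-adic twist of `u`, `g_⊥ = 1.07 (M=12) … 1.24 (480) ↑ 2 log 2`). First brick of B7. [M–L, NEW] -/
theorem divisorGraph_gap_perp (M : ℕ) (hM : 12 ≤ M) (y : ℕ → ℂ)
    (hperp : ∑ m ∈ Finset.Icc 1 M, y m * ((Real.sqrt (m : ℝ) : ℝ) : ℂ)⁻¹ = 0) :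
    ∑ m ∈ Finset.Icc 1 M, ‖y m‖ ^ 2 ≤ dirichletD M y := by
  sorry

/-- **B7 (THE HARD ONE — pole-free coercivity on `u^⊥`, k2-HL6 = k1-L6; register as `stub_perpCoercivityTop`, fully inlined)**:
for `y ⊥ u` on a top cell, `Re Q(g_y) ≥ κ₀·U·‖y‖²`, `κ₀ = 1/5` (truth `0.5–0.62`, siege k8 / k2). On `u^⊥` the pole vanishes
identically (`A₋(y) = 0`) and `Q(g_y)/U = D(y) + Off(y)/U − (log 2 + γ − c_d + o(1))‖y‖² − Σ_m E₁(M/m)‖y_m‖²`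
(energy form `weilQuadratic_comb_re_window_energyForm`), `log 2 + γ − c_d = −0.685`. Mechanism OPEN (see plan §B7). [XL] -/
theorem perp_coercivity_topCells_inline : ∀ ε : ℝ, 0 < ε → ∀ (M : ℕ) (y : ℕ → ℂ), 400 ≤ M →
    2 * ε * ((M : ℝ) + 1) ≤ 1 → 1 < 2 * ε * ((M : ℝ) + 2) →
    ∑ m ∈ Finset.Icc 1 M, y m * ((Real.sqrt (m : ℝ) : ℝ) : ℂ)⁻¹ = 0 →
    1 / 5 * (ε⁻¹ * weilNorm2Sq (fun u : ℝ => ((expNegInvGlue (1 - u ^ 2) : ℝ) : ℂ))) *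
        ∑ m ∈ Finset.Icc 1 M, ‖y m‖ ^ 2 ≤
      (weilQuadratic (fun x : ℝ => ∑ m ∈ Finset.Icc 1 M,
        y m * ((ε : ℂ)⁻¹ * ((expNegInvGlue (1 - ((x - Real.log (m : ℝ)) / ε) ^ 2) : ℝ) : ℂ)))).re := by
  sorry

/-- **B8 (closure arithmetic)**: `c_* ≤ μ̂ κ₀ H_M` with `1/16 ≤ (1/20)(1/5)H_M` iff `H_M ≥ 6.25`, true for `M ≥ 400` (`H_400 = 6.57`). [S] -/
theorem closure_constants (M : ℕ) (hM : 400 ≤ M) :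
    (1 : ℝ) / 16 ≤ 1 / 20 * (1 / 5) * ∑ m ∈ Finset.Icc 1 M, (1 : ℝ) / m := by
  sorry

/-- **B9 (assembly of the analytic half; M-sized plumbing)**: `stub_gram` (bilinear Gram form, real even symbol p93312) +
`a = βu + y`, `β = A₋(a)/H_M` + B3 with B4/B5/B7/B8 ⟹ `TopCellsFrom 400`. -/
theorem topCellsFrom_of_pivot
    (hRay : ∀ ε : ℝ, 0 < ε → ∀ M : ℕ, 400 ≤ M → 2 * ε * ((M : ℝ) + 1) ≤ 1 → 1 < 2 * ε * ((M : ℝ) + 2) →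
      1 / 20 * (ε⁻¹ * N0) * (∑ m ∈ Finset.Icc 1 M, (1 : ℝ) / m) ≤ (weilQuadratic (comb ε M perron)).re)
    (hcross : ∀ ε : ℝ, 0 < ε → ∀ (M : ℕ) (y : ℕ → ℂ), 400 ≤ M → 2 * ε * ((M : ℝ) + 1) ≤ 1 →
      1 < 2 * ε * ((M : ℝ) + 2) → ∑ m ∈ Finset.Icc 1 M, y m * ((Real.sqrt (m : ℝ) : ℝ) : ℂ)⁻¹ = 0 →
      ‖weilFunctional (weilConv (comb ε M perron) (weilReflect (comb ε M y)))‖ ^ 2 ≤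
        1 / 16 * (ε⁻¹ * N0) ^ 2 * ∑ m ∈ Finset.Icc 1 M, ‖y m‖ ^ 2)
    (hcoer : ∀ ε : ℝ, 0 < ε → ∀ (M : ℕ) (y : ℕ → ℂ), 400 ≤ M → 2 * ε * ((M : ℝ) + 1) ≤ 1 →
      1 < 2 * ε * ((M : ℝ) + 2) → ∑ m ∈ Finset.Icc 1 M, y m * ((Real.sqrt (m : ℝ) : ℝ) : ℂ)⁻¹ = 0 →
      1 / 5 * (ε⁻¹ * N0) * ∑ m ∈ Finset.Icc 1 M, ‖y m‖ ^ 2 ≤ (weilQuadratic (comb ε M y)).re) :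
    TopCellsFrom 400 := by
  sorry

/-- **Final composition shape** (all by NAME): B9 + the certified complement ⟹ the registered stub. -/
theorem stub_windowCore_of_plan (hcells : TopCellsBelow 400) (hlarge : TopCellsFrom 400) :
    ∀ ε : ℝ, 0 < ε → ∀ (M : ℕ) (a : ℕ → ℂ), 1 ≤ M → 1 / 40 < ε * M →
      2 * ε * ((M : ℝ) + 1) ≤ 1 → CoreIneq ε M a :=
  stub_windowCore_of_topCells_split 400 hcells hlarge

end Summit.RiemannHypothesis.RiemannHypothesis.Cruxes.CombShapePositivity.StubPlanWindowCore

end
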